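import Summits.Schanuel.Schanuel.Theses.RoyCriterion
import Mathlib.NumberTheory.Transcendental.Liouville.Basic

/-!
# A fast Liouville number for the `∃ᶠ`-refutation of `RoySmallValueDirichletGap` (crux `stmt-Schanuel-1050`)

The number `η∞ = ∑ₙ 2^{-e(n)}` with `e(n) = 2^{4ⁿ}` (so `e(n+1) = e(n)⁴`), written inline as
`∑' n, ((2:ℝ) ^ 2 ^ 4 ^ n)⁻¹` (no definitions): summable, `0 < η∞ ≤ 1/2`, partial sums
`s_n = a_n / 2^{e(n)}` (`partialSum_eq`), tail `0 < η∞ − s_n ≤ 2 · 2^{−e(n+1)}` (`tail_bounds`),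
Liouville (`liouville_eta`), hence transcendental — also as a complex number over `ℚ`
(`transcendental_eta`, via `Liouville.transcendental`, `isAlgebraic_algebraMap_iff` and
`IsAlgebraic.restrictScalars`). Used by `Negative/FrequentlyFalse.lean`: at `(0, η∞)` the crux's
small-value hypothesis holds for infinitely many `D`, so the `∃ᶠ D`-weakening of
`Summit.Schanuel.Schanuel.Theses.RoyCriterion.RoySmallValueDirichletGap` is false. Everything is
proved; no definitions, no named facts.
-/

noncomputable section

namespace Summit.Schanuel.Schanuel.Theorems.RoySmallValueDirichletGapFrequently

open Filter Finset Complex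

/-! ### The exponent sequence `e(n) = 2^{4ⁿ}` -/

/-- `e(n+1) = e(n)⁴`. [folklore] -/
theorem e_succ (n : ℕ) : (2 : ℕ) ^ 4 ^ (n + 1) = (2 ^ 4 ^ n) ^ 4 := by
  rw [pow_succ, pow_mul]

/-- `2 ≤ e(n)`. [folklore] -/
theorem two_le_e (n : ℕ) : 2 ≤ (2 : ℕ) ^ 4 ^ n :=
  calc (2 : ℕ) = 2 ^ 1 := rfl
    _ ≤ 2 ^ 4 ^ n := Nat.pow_le_pow_right (by norm_num) (Nat.one_le_pow _ _ (by norm_num))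

/-- `e(n) + 1 ≤ e(n+1)` (indeed much more). [folklore] -/
theorem e_succ_ge (n : ℕ) : (2 : ℕ) ^ 4 ^ n + 1 ≤ 2 ^ 4 ^ (n + 1) := by
  rw [e_succ]
  have h := two_le_e n
  set x := (2 : ℕ) ^ 4 ^ n
  calc x + 1 ≤ x * x := by nlinarith
    _ ≤ x * x * (x * x) := Nat.le_mul_of_pos_right _ (by positivity)
    _ = x ^ 4 := by ring

/-- `e` is strictly monotone, quantitatively: `e(n) + i ≤ e(n + i)`. [folklore] -/
theorem e_add_ge (n i : ℕ) : (2 : ℕ) ^ 4 ^ n + i ≤ 2 ^ 4 ^ (n + i) := by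
  induction i with
  | zero => simp
  | succ i ih =>
    calc (2 : ℕ) ^ 4 ^ n + (i + 1) = (2 ^ 4 ^ n + i) + 1 := by ring
      _ ≤ 2 ^ 4 ^ (n + i) + 1 := by omega
      _ ≤ 2 ^ 4 ^ (n + i + 1) := e_succ_ge _
      _ = 2 ^ 4 ^ (n + (i + 1)) := by rw [add_assoc]

/-- `e(m) ≤ e(n)` for `m ≤ n`. [folklore] -/
theorem e_mono {m n : ℕ} (h : m ≤ n) : (2 : ℕ) ^ 4 ^ m ≤ 2 ^ 4 ^ n :=
  Nat.pow_le_pow_right (by norm_num) (Nat.pow_le_pow_right (by norm_num) h)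

/-- `n + 2 ≤ e(n)`. [folklore] -/
theorem add_two_le_e (n : ℕ) : n + 2 ≤ (2 : ℕ) ^ 4 ^ n := by
  have := e_add_ge 0 n
  simpa [add_comm] using this

/-! ### The number `η∞ = ∑ₙ 2^{-e(n)}` -/

/-- The terms are bounded by a geometric sequence: `2^{-e(n)} ≤ (1/2)^{n+2}`. [folklore] -/
theorem term_le_geom (n : ℕ) : ((2 : ℝ) ^ 2 ^ 4 ^ n)⁻¹ ≤ (1 / 2 : ℝ) ^ (n + 2) := by
  rw [one_div, inv_pow]
  exact inv_anti₀ (by positivity) (pow_le_pow_right₀ (by norm_num) (add_two_le_e n))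

/-- The terms are positive. [folklore] -/
theorem term_pos (n : ℕ) : 0 < ((2 : ℝ) ^ 2 ^ 4 ^ n)⁻¹ := by positivity

/-- The dominating geometric series is summable. [folklore] -/
theorem summable_geom_shift : Summable fun n : ℕ => (1 / 2 : ℝ) ^ (n + 2) :=
  (summable_nat_add_iff (f := fun n : ℕ => (1 / 2 : ℝ) ^ n) 2).2
    (summable_geometric_of_lt_one (by norm_num : (0:ℝ) ≤ 1 / 2) (by norm_num : (1 / 2 : ℝ) < 1))

/-- Summability of `∑ 2^{-e(n)}`. [folklore] -/
theorem summable_terms : Summable fun n : ℕ => ((2 : ℝ) ^ 2 ^ 4 ^ n)⁻¹ :=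
  Summable.of_nonneg_of_le (fun n => (term_pos n).le) term_le_geom summable_geom_shift

/-- `0 < η∞`. [folklore] -/
theorem eta_pos : 0 < ∑' n : ℕ, ((2 : ℝ) ^ 2 ^ 4 ^ n)⁻¹ :=
  summable_terms.tsum_pos (fun n => (term_pos n).le) 0 (term_pos 0)

/-- `η∞ ≤ 1/2 < 1`. [folklore] -/
theorem eta_le_half : ∑' n : ℕ, ((2 : ℝ) ^ 2 ^ 4 ^ n)⁻¹ ≤ 1 / 2 := by
  calc ∑' n : ℕ, ((2 : ℝ) ^ 2 ^ 4 ^ n)⁻¹ ≤ ∑' n : ℕ, (1 / 2 : ℝ) ^ (n + 2) :=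
        Summable.tsum_le_tsum term_le_geom summable_terms summable_geom_shift
    _ = ∑' n : ℕ, (1 / 2 : ℝ) ^ 2 * (1 / 2 : ℝ) ^ n := by
        congr 1; ext n; ring
    _ = (1 / 2 : ℝ) ^ 2 * ∑' n : ℕ, (1 / 2 : ℝ) ^ n := tsum_mul_left
    _ = 1 / 2 := by
        rw [tsum_geometric_of_lt_one (by norm_num) (by norm_num)]; norm_num

/-- The numerator of the `n`-th partial sum: `a_n = ∑_{m ≤ n} 2^{e(n) − e(m)}`. We use it inline. -/
theorem partialSum_eq (n : ℕ) :
    ∑ m ∈ range (n + 1), ((2 : ℝ) ^ 2 ^ 4 ^ m)⁻¹ =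
      ((∑ m ∈ range (n + 1), (2 : ℕ) ^ (2 ^ 4 ^ n - 2 ^ 4 ^ m) : ℕ) : ℝ) / (2 : ℝ) ^ 2 ^ 4 ^ n := by
  push_cast
  rw [Finset.sum_div]
  refine Finset.sum_congr rfl fun m hm => ?_
  have hmn : m ≤ n := Nat.lt_succ_iff.1 (Finset.mem_range.1 hm)
  have hle : 2 ^ 4 ^ m ≤ 2 ^ 4 ^ n := e_mono hmn
  rw [eq_div_iff (by positivity), ← pow_sub_mul_pow (2 : ℝ) hle, mul_comm ((2 : ℝ) ^ _) ((2 : ℝ) ^ _),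
    ← mul_assoc, inv_mul_cancel₀ (by positivity), one_mul]

/-- The numerator is positive. [folklore] -/
theorem numerator_pos (n : ℕ) : 0 < ∑ m ∈ range (n + 1), (2 : ℕ) ^ (2 ^ 4 ^ n - 2 ^ 4 ^ m) :=
  Finset.sum_pos (fun m _ => by positivity) ⟨0, by simp⟩

/-- **Tail bound**: `0 < η∞ − s_n ≤ 2 · 2^{−e(n+1)}`. [folklore] -/
theorem tail_bounds (n : ℕ) :
    0 < (∑' m : ℕ, ((2 : ℝ) ^ 2 ^ 4 ^ m)⁻¹) - ∑ m ∈ range (n + 1), ((2 : ℝ) ^ 2 ^ 4 ^ m)⁻¹ ∧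
    (∑' m : ℕ, ((2 : ℝ) ^ 2 ^ 4 ^ m)⁻¹) - ∑ m ∈ range (n + 1), ((2 : ℝ) ^ 2 ^ 4 ^ m)⁻¹ ≤
      2 * ((2 : ℝ) ^ 2 ^ 4 ^ (n + 1))⁻¹ := by
  have hsplit := (summable_terms.sum_add_tsum_nat_add (n + 1))
  have htail : (∑' m : ℕ, ((2 : ℝ) ^ 2 ^ 4 ^ m)⁻¹) - ∑ m ∈ range (n + 1), ((2 : ℝ) ^ 2 ^ 4 ^ m)⁻¹ =
      ∑' m : ℕ, ((2 : ℝ) ^ 2 ^ 4 ^ (m + (n + 1)))⁻¹ := by rw [← hsplit]; ring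
  rw [htail]
  have hsum' : Summable fun m : ℕ => ((2 : ℝ) ^ 2 ^ 4 ^ (m + (n + 1)))⁻¹ :=
    (summable_nat_add_iff (f := fun m : ℕ => ((2 : ℝ) ^ 2 ^ 4 ^ m)⁻¹) (n + 1)).2 summable_terms
  constructor
  · exact hsum'.tsum_pos (fun m => (term_pos _).le) 0 (term_pos _)
  · -- compare with the geometric series `2^{-e(n+1)} (1/2)^m`
    have hcmp : ∀ m : ℕ, ((2 : ℝ) ^ 2 ^ 4 ^ (m + (n + 1)))⁻¹ ≤ ((2 : ℝ) ^ 2 ^ 4 ^ (n + 1))⁻¹ * (1 / 2 : ℝ) ^ m := by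
      intro m
      rw [one_div, inv_pow, ← mul_inv, ← pow_add]
      refine inv_anti₀ (by positivity) (pow_le_pow_right₀ (by norm_num) ?_)
      have := e_add_ge (n + 1) m
      rw [add_comm m]; exact this
    have hgs : Summable fun m : ℕ => ((2 : ℝ) ^ 2 ^ 4 ^ (n + 1))⁻¹ * (1 / 2 : ℝ) ^ m :=
      (summable_geometric_of_lt_one (by norm_num : (0:ℝ) ≤ 1 / 2)
        (by norm_num : (1 / 2 : ℝ) < 1)).mul_left _
    calc ∑' m : ℕ, ((2 : ℝ) ^ 2 ^ 4 ^ (m + (n + 1)))⁻¹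
        ≤ ∑' m : ℕ, ((2 : ℝ) ^ 2 ^ 4 ^ (n + 1))⁻¹ * (1 / 2 : ℝ) ^ m :=
          Summable.tsum_le_tsum hcmp hsum' hgs
      _ = ((2 : ℝ) ^ 2 ^ 4 ^ (n + 1))⁻¹ * ∑' m : ℕ, (1 / 2 : ℝ) ^ m := tsum_mul_left
      _ = ((2 : ℝ) ^ 2 ^ 4 ^ (n + 1))⁻¹ * 2 := by
          rw [tsum_geometric_of_lt_one (by norm_num) (by norm_num)]; norm_num
      _ = 2 * ((2 : ℝ) ^ 2 ^ 4 ^ (n + 1))⁻¹ := by ring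

/-- The numerical heart of the Liouville property: `2 · 2^{-e(k)⁴} < (2^{e(k)})^{-k}`. [folklore] -/
theorem liouville_ineq (k : ℕ) :
    (2 : ℝ) * ((2 : ℝ) ^ (2 ^ 4 ^ k) ^ 4)⁻¹ < 1 / ((2 : ℝ) ^ 2 ^ 4 ^ k) ^ k := by
  have h2 := two_le_e k
  have hk := add_two_le_e k
  generalize 2 ^ 4 ^ k = x at h2 hk ⊢
  rw [one_div, ← pow_mul]
  have hlt : x * k + 1 < x ^ 4 := by
    calc x * k + 1 < x * x := by nlinarith
      _ ≤ x * x * (x * x) := Nat.le_mul_of_pos_right _ (by positivity)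
      _ = x ^ 4 := by ring
  have h1 : (2 : ℝ) ^ (x * k + 1) < (2 : ℝ) ^ (x ^ 4) := pow_lt_pow_right₀ (by norm_num) hlt
  rw [← div_eq_mul_inv, ← one_div, div_lt_div_iff₀ (by positivity) (by positivity), one_mul,
    ← pow_succ']
  exact h1

/-- **`η∞` is a Liouville number.** [folklore] -/
theorem liouville_eta : Liouville (∑' n : ℕ, ((2 : ℝ) ^ 2 ^ 4 ^ n)⁻¹) := by
  intro k
  -- use the partial sum of order `n = k`
  obtain ⟨hpos, hle⟩ := tail_bounds k
  rw [e_succ] at hle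
  have haR : ((((∑ m ∈ range (k + 1), (2 : ℕ) ^ (2 ^ 4 ^ k - 2 ^ 4 ^ m) : ℕ) : ℤ) : ℝ) /
      (((2 ^ 2 ^ 4 ^ k : ℕ) : ℤ) : ℝ)) = ∑ m ∈ range (k + 1), ((2 : ℝ) ^ 2 ^ 4 ^ m)⁻¹ := by
    rw [partialSum_eq k]; push_cast; ring
  have hbR : (((2 ^ 2 ^ 4 ^ k : ℕ) : ℤ) : ℝ) = (2 : ℝ) ^ 2 ^ 4 ^ k := by push_cast; ring
  refine ⟨(∑ m ∈ range (k + 1), (2 : ℕ) ^ (2 ^ 4 ^ k - 2 ^ 4 ^ m) : ℕ), (2 ^ 2 ^ 4 ^ k : ℕ), ?_, ?_, ?_⟩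
  · exact_mod_cast one_lt_pow₀ (by norm_num : (1 : ℕ) < 2) (by positivity : 2 ^ 4 ^ k ≠ 0)
  · intro heq
    rw [haR] at heq
    linarith
  · rw [haR, hbR, abs_of_pos hpos]
    exact lt_of_le_of_lt hle (liouville_ineq k)


/-- **`η∞` is transcendental** (as a complex number, over `ℚ`). [folklore] -/
theorem transcendental_eta : ¬ IsAlgebraic ℚ ((∑' n : ℕ, ((2 : ℝ) ^ 2 ^ 4 ^ n)⁻¹ : ℝ) : ℂ) := by
  intro halg
  haveI : Algebra.IsAlgebraic ℤ ℚ := IsLocalization.isAlgebraic ℚ (nonZeroDivisors ℤ)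
  have hZ : IsAlgebraic ℤ ((∑' n : ℕ, ((2 : ℝ) ^ 2 ^ 4 ^ n)⁻¹ : ℝ) : ℂ) := halg.restrictScalars ℤ
  have hZ' : IsAlgebraic ℤ (algebraMap ℝ ℂ (∑' n : ℕ, ((2 : ℝ) ^ 2 ^ 4 ^ n)⁻¹)) := by
    rw [Complex.coe_algebraMap]; exact hZ
  have hR : IsAlgebraic ℤ (∑' n : ℕ, ((2 : ℝ) ^ 2 ^ 4 ^ n)⁻¹) :=
    (isAlgebraic_algebraMap_iff (algebraMap ℝ ℂ).injective).1 hZ'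
  exact liouville_eta.transcendental hR

end Summit.Schanuel.Schanuel.Theorems.RoySmallValueDirichletGapFrequently

end
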